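import Summits.QuantumFields.YangMills.Theorems.BalabanUVNodesN18KingModelTopPiece

/-!
# BalabanUVNodes ∕ N18 — the TWO-FACTOR knit for King's top-scale piece `G^η_{(K)}(x, y) = Σ_b C^ηQ^*_K(y, b)·ℋ_K(x, b)`:
# one-anchor and pair-anchor columns ⟹ `NE5` with ONE `θ`; the symmetry of `G^η_{(K)}` and the kernel identities that put
# `∂^η_μ`, `∂_α(x, y)`, `∂_α(x, y)∂^η_μ` on the minimiser factor (Track A, DAG node N18 = NE5
# `T4OutputRate.NE5 EA EB W κ θ C₅` :211; cluster K4; the -a∕-b loop on the PRINTED MODEL, seventh display)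

HONEST FRAMING.  Count-neutral kernel bookkeeping (seat pub-ymgap-dag-n18-a g5; `--supports stmt-QuantumFields-19182`).
King's A = 0 scalar MODEL of the NE5 mechanism (template literature, published and proved) — NOT Bałaban's covariant
one-step outputs `E^{(j)}(X; g, U)`, for which NE5 is NOT IN PRINT and has no tree producer (NODE O 0∕1); NOT a node
discharge; finite tori; nothing continuum ∕ ℝ⁴ ∕ OS ∕ mass-gap ∕ Clay.  THEOREMS ONLY: 0 `def`, 0 `sorry`, standard axioms.

THE POINT.  King p. 675: «Finally, Proposition 3.9 holds for G^η_{(K)} from the convergence of C^ηQ^*_K and a_KQ_KG^η_K, and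
the scalings of the operators» — i.e. EVERY entry of (3.73) ∕ (3.75) is claimed for the top piece too.  n18-b's file 14d
(`TopScalePiece`, p422394) typed the kernel `G^η_{(K)}(x, y) = Σ_b C^ηQ^*_K(x, b)·ℋ_K(y, b)` ((4.44) entrywise) and the
UNDIFFERENCED line; `N18KingModelTopPiece` (p424672) made it an `NE5` inhabitant.  For the DERIVATIVE and HÖLDER entries the
operator `∂^η_μ` ∕ `∂_α(x, y)` acts on the FIRST variable, where (4.44) has the `C^ηQ^*_K` factor (no derivative estimate
in the tree); but `G^η_{(K)} = N^d(B⁻¹ − A₀⁻¹)` is SYMMETRIC (`lapF_comm`, `fineOp_transpose`), so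
`G^η_{(K)}(x, y) = Σ_b C^ηQ^*_K(y, b)·ℋ_K(x, b)` and the operator lands on the MINIMISER factor, whose derivative ∕ Hölder
rows are n18-b's files 10 ∕ 13.  This file supplies the bookkeeping:
* §1 the TWO-FACTOR bounds on any index set with a pseudo-distance and lattice sums (`exp_conv_le` BY NAME):
  `dot2_sub_dot2` (`Σu′v′ − Σuv = Σ(u′−u)v′ + Σu(v′−v)`), `dot2_decay_bound` (row anchored at `p`, column at `q` ⟹
  `abK(δ)e^{−δρ(p,q)}`), `dot2_decay_bound_pair` (column anchored at the PAIR `q₁, q₂` ⟹ `2abK(δ)e^{−δ·min(ρ(p,q₁),ρ(p,q₂))}`,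
  split by the nearer anchor), `dot2_rate`, `dot2_rate_pair`.
* §2 the multi-scale knits on a scale-indexed torus family: `ne5_of_twoFactorRates_torus` (`C.d X ≤ ρ(p X, q X)` ⟹
  `NE5 EA EB W δ θ ((cA·b + a·cB)·K_d(δ))`), `ne5_of_twoFactorRates_pair_torus` (`C.d X ≤ min(ρ(p X, q₁ X), ρ(p X, q₂ X))`
  ⟹ `NE5 EA EB W δ θ (2(cA·b + a·cB)·K_d(δ))`), ONE `θ` for all scales.
* §3 `topPiece_symm` (`G^η_{(K)}(x, y) = G^η_{(K)}(y, x)`), `topPiece_kernel_eq_sum'` (`= Σ_b C^ηQ^*_K(y, b)·ℋ_K(x, b)`),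
  `dtopPiece_eq_sum` (`r·(G(x + e, y) − G(x, y)) = Σ_b C^ηQ^*_K(y, b)·r(ℋ_K(x + e, b) − ℋ_K(x, b))` — the lattice
  derivative in the first variable), `htopPiece_eq_sum` (the Hölder quotient `r·(G(x, z) − G(y, z))`), `hdtopPiece_eq_sum`
  (the Hölder quotient of the derivative).
The torus theorems — (3.73) second entry and (3.75) both entries FOR `G^η_{(K)}`, unconditional — are the companion files
`BalabanUVNodesN18KingModelTopPieceDeriv` ∕ `…TopPieceHolder`.
NOT COVERED ∕ PINS (standing): A = 0, `g`∕`U` unread; periodic b.c.; (2.20) rescaling; `t`-derivatives via `m²(t)`; the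
bearing on Bałaban's `E^{(j)}(X; g, U)` is NIL (NODE O + rows NE2∕NE3).

Sources: C. King, Commun. Math. Phys. **102** (1986) 649–677 [King1986] — p. 675 (4.44)–(4.45), Prop. 3.9 (3.73)∕(3.75)
p. 665, (3.62) p. 663, Prop. 3.7 (3.64) p. 663; T. Bałaban, Commun. Math. Phys. **109** (1987) 249–301 [Balaban1987RG1] —
(0.25) p. 257, Thm 1 p. 259 (uniformity in ε, the only printed trace of NE5).  No claim about the mass gap.
-/

noncomputable section

namespace Summit.QuantumFields.YangMills.BalabanUVNodes.N18KingModelTwoFactor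

open Real Matrix
open Literature.MathematicalPhysics.QuantumFieldTheory.Balaban1983to89.T4OutputRate (Carriers Functional NE5)
open Literature.MathematicalPhysics.QuantumFieldTheory.Balaban1983to89.B5Prop11Plancherel (Tor fine)
open Literature.MathematicalPhysics.QuantumFieldTheory.Balaban1983to89.B4Sect5Proof (latticeConst latticeConst_nonneg)
open Literature.MathematicalPhysics.QuantumFieldTheory.Balaban1983to89.B4Sect5Torus (IsPseudoDist SumBound)
open Literature.MathematicalPhysics.QuantumFieldTheory.King1986.Torus
  (topPiece covQstar minimiser lapF fineOp lapF_comm fineOp_transpose topPiece_kernel_eq_sum tdistT tdistT_isPseudoDist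
    tdistT_sumBound exp_conv_le)

/-! ## §1 Two-factor bounds: one differenced line at a time, one-anchor and pair-anchor columns -/

section TwoFactor

variable {n : Type*} [Fintype n]

/-- «The error is the same graph with a difference of propagators on one line» for a TWO-factor graph:
`Σu′v′ − Σuv = Σ(u′ − u)v′ + Σu(v′ − v)`. [cite: King1986, p.665 and p.675] -/
theorem dot2_sub_dot2 (u u' v v' : n → ℝ) :
    ∑ z, u' z * v' z - ∑ z, u z * v z = ∑ z, (u' z - u z) * v' z + ∑ z, u z * (v' z - v z) := by
  rw [← Finset.sum_sub_distrib, ← Finset.sum_add_distrib]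
  exact Finset.sum_congr rfl fun z _ => by ring

/-- **Two-factor decay**: a row anchored at `p` (`|u z| ≤ a e^{−δ₁ρ(p,z)}`) against a column anchored at `q`
(`|v z| ≤ b e^{−δ₂ρ(q,z)}`), `2δ ≤ δ₁, δ₂`, lattice sums `K` ⟹ `|Σ_z u z v z| ≤ abK(δ)e^{−δρ(p,q)}` (`exp_conv_le`).
[cite: King1986, Prop. 3.7 (3.64) p.663, p.675] -/
theorem dot2_decay_bound {ρ : n → n → ℝ} (hρ : IsPseudoDist ρ) {K : ℝ → ℝ} (hS : SumBound ρ K) (p q : n)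
    (u v : n → ℝ) {a b δ₁ δ₂ δ : ℝ} (ha : 0 ≤ a) (hb : 0 ≤ b) (hδ : 0 < δ) (h1 : 2 * δ ≤ δ₁) (h2 : 2 * δ ≤ δ₂)
    (hu : ∀ z, |u z| ≤ a * Real.exp (-(δ₁ * ρ p z)))
    (hv : ∀ z, |v z| ≤ b * Real.exp (-(δ₂ * ρ q z))) :
    |∑ z, u z * v z| ≤ a * b * K δ * Real.exp (-(δ * ρ p q)) := by
  have hconv := exp_conv_le hρ hS hδ h1 h2 p q
  have hK : 0 ≤ K δ := (Finset.sum_nonneg fun z _ => (Real.exp_pos _).le).trans (hS δ hδ p)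
  calc |∑ z, u z * v z| ≤ ∑ z, |u z * v z| := Finset.abs_sum_le_sum_abs _ _
    _ ≤ ∑ z, (a * Real.exp (-(δ₁ * ρ p z))) * (b * Real.exp (-(δ₂ * ρ z q))) := by
        refine Finset.sum_le_sum fun z _ => ?_
        rw [abs_mul]
        have hv' := hv z
        rw [hρ.symm q z] at hv'
        exact mul_le_mul (hu z) hv' (abs_nonneg _) (by positivity)
    _ = a * b * ∑ z, Real.exp (-(δ₁ * ρ p z)) * Real.exp (-(δ₂ * ρ z q)) := by
        rw [Finset.mul_sum]
        exact Finset.sum_congr rfl fun z _ => by ring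
    _ ≤ a * b * (K δ * Real.exp (-(δ * ρ p q))) := mul_le_mul_of_nonneg_left hconv (by positivity)
    _ = a * b * K δ * Real.exp (-(δ * ρ p q)) := by ring

/-- **Two-factor decay with a PAIR-anchored column** (the Hölder quotient `∂_α(x, y)` decays from the nearer of `B(x), B(y)`):
`|v z| ≤ b e^{−δ₂·min(ρ(q₁,z), ρ(q₂,z))}` ⟹ `|Σ_z u z v z| ≤ 2abK(δ)e^{−δ·min(ρ(p,q₁), ρ(p,q₂))}` — split the column by the
nearer anchor and apply `dot2_decay_bound` twice. [cite: King1986, (3.75) p.665, p.675] -/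
theorem dot2_decay_bound_pair {ρ : n → n → ℝ} (hρ : IsPseudoDist ρ) {K : ℝ → ℝ} (hS : SumBound ρ K) (p q₁ q₂ : n)
    (u v : n → ℝ) {a b δ₁ δ₂ δ : ℝ} (ha : 0 ≤ a) (hb : 0 ≤ b) (hδ : 0 < δ) (h1 : 2 * δ ≤ δ₁) (h2 : 2 * δ ≤ δ₂)
    (hu : ∀ z, |u z| ≤ a * Real.exp (-(δ₁ * ρ p z)))
    (hv : ∀ z, |v z| ≤ b * Real.exp (-(δ₂ * min (ρ q₁ z) (ρ q₂ z)))) :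
    |∑ z, u z * v z| ≤ 2 * (a * b * K δ) * Real.exp (-(δ * min (ρ p q₁) (ρ p q₂))) := by
  classical
  set v₁ : n → ℝ := fun z => if ρ q₁ z ≤ ρ q₂ z then v z else 0 with hv₁
  set v₂ : n → ℝ := fun z => if ρ q₁ z ≤ ρ q₂ z then 0 else v z with hv₂
  have hsplit : ∀ z, u z * v z = u z * v₁ z + u z * v₂ z := by
    intro z
    simp only [hv₁, hv₂]
    split_ifs <;> simp
  have e1 : ∀ z, |v₁ z| ≤ b * Real.exp (-(δ₂ * ρ q₁ z)) := by
    intro z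
    simp only [hv₁]
    split_ifs with h
    · have h' := hv z
      rwa [min_eq_left h] at h'
    · rw [abs_zero]; positivity
  have e2 : ∀ z, |v₂ z| ≤ b * Real.exp (-(δ₂ * ρ q₂ z)) := by
    intro z
    simp only [hv₂]
    split_ifs with h
    · rw [abs_zero]; positivity
    · have h' := hv z
      rwa [min_eq_right (le_of_lt (not_le.mp h))] at h'
  have b1 := dot2_decay_bound hρ hS p q₁ u v₁ ha hb hδ h1 h2 hu e1
  have b2 := dot2_decay_bound hρ hS p q₂ u v₂ ha hb hδ h1 h2 hu e2
  have hK : 0 ≤ K δ := (Finset.sum_nonneg fun z _ => (Real.exp_pos _).le).trans (hS δ hδ p)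
  have hc : 0 ≤ a * b * K δ := by positivity
  have f1 : Real.exp (-(δ * ρ p q₁)) ≤ Real.exp (-(δ * min (ρ p q₁) (ρ p q₂))) :=
    Real.exp_le_exp.mpr (neg_le_neg (mul_le_mul_of_nonneg_left (min_le_left _ _) hδ.le))
  have f2 : Real.exp (-(δ * ρ p q₂)) ≤ Real.exp (-(δ * min (ρ p q₁) (ρ p q₂))) :=
    Real.exp_le_exp.mpr (neg_le_neg (mul_le_mul_of_nonneg_left (min_le_right _ _) hδ.le))
  rw [Finset.sum_congr rfl fun z _ => hsplit z, Finset.sum_add_distrib]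
  calc |∑ z, u z * v₁ z + ∑ z, u z * v₂ z| ≤ |∑ z, u z * v₁ z| + |∑ z, u z * v₂ z| := abs_add_le _ _
    _ ≤ a * b * K δ * Real.exp (-(δ * ρ p q₁)) + a * b * K δ * Real.exp (-(δ * ρ p q₂)) := add_le_add b1 b2
    _ ≤ a * b * K δ * Real.exp (-(δ * min (ρ p q₁) (ρ p q₂)))
        + a * b * K δ * Real.exp (-(δ * min (ρ p q₁) (ρ p q₂))) :=
        add_le_add (mul_le_mul_of_nonneg_left f1 hc) (mul_le_mul_of_nonneg_left f2 hc)
    _ = 2 * (a * b * K δ) * Real.exp (-(δ * min (ρ p q₁) (ρ p q₂))) := by ring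

/-- **Two-factor rate** («from the convergence of C^ηQ^*_K and a_KQ_KG^η_K», p. 675): rows `u, u′` anchored at `p` (size `a`,
difference `εA`), columns `v, v′` anchored at `q` (size `b`, difference `εB`) ⟹
`|Σu′v′ − Σuv| ≤ (εA·b + a·εB)·K(δ)·e^{−δρ(p,q)}`. [cite: King1986, p.675] -/
theorem dot2_rate {ρ : n → n → ℝ} (hρ : IsPseudoDist ρ) {K : ℝ → ℝ} (hS : SumBound ρ K) (p q : n)
    (u u' v v' : n → ℝ) {a b εA εB δ₁ δ₂ δ : ℝ} (ha : 0 ≤ a) (hb : 0 ≤ b) (hεA : 0 ≤ εA) (hεB : 0 ≤ εB)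
    (hδ : 0 < δ) (h1 : 2 * δ ≤ δ₁) (h2 : 2 * δ ≤ δ₂)
    (hu : ∀ z, |u z| ≤ a * Real.exp (-(δ₁ * ρ p z)))
    (hv' : ∀ z, |v' z| ≤ b * Real.exp (-(δ₂ * ρ q z)))
    (hdu : ∀ z, |u' z - u z| ≤ εA * Real.exp (-(δ₁ * ρ p z)))
    (hdv : ∀ z, |v' z - v z| ≤ εB * Real.exp (-(δ₂ * ρ q z))) :
    |∑ z, u' z * v' z - ∑ z, u z * v z| ≤ (εA * b + a * εB) * K δ * Real.exp (-(δ * ρ p q)) := by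
  rw [dot2_sub_dot2]
  have b1 := dot2_decay_bound hρ hS p q (fun z => u' z - u z) v' hεA hb hδ h1 h2 hdu hv'
  have b2 := dot2_decay_bound hρ hS p q u (fun z => v' z - v z) ha hεB hδ h1 h2 hu hdv
  calc |∑ z, (u' z - u z) * v' z + ∑ z, u z * (v' z - v z)|
      ≤ |∑ z, (u' z - u z) * v' z| + |∑ z, u z * (v' z - v z)| := abs_add_le _ _
    _ ≤ εA * b * K δ * Real.exp (-(δ * ρ p q)) + a * εB * K δ * Real.exp (-(δ * ρ p q)) := add_le_add b1 b2
    _ = (εA * b + a * εB) * K δ * Real.exp (-(δ * ρ p q)) := by ring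

/-- **Two-factor rate with a PAIR-anchored column**: as `dot2_rate` with `v, v′` and their difference decaying from the nearer
of `q₁, q₂` ⟹ `|Σu′v′ − Σuv| ≤ 2(εA·b + a·εB)·K(δ)·e^{−δ·min(ρ(p,q₁), ρ(p,q₂))}`. [cite: King1986, (3.75) p.665, p.675] -/
theorem dot2_rate_pair {ρ : n → n → ℝ} (hρ : IsPseudoDist ρ) {K : ℝ → ℝ} (hS : SumBound ρ K) (p q₁ q₂ : n)
    (u u' v v' : n → ℝ) {a b εA εB δ₁ δ₂ δ : ℝ} (ha : 0 ≤ a) (hb : 0 ≤ b) (hεA : 0 ≤ εA) (hεB : 0 ≤ εB)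
    (hδ : 0 < δ) (h1 : 2 * δ ≤ δ₁) (h2 : 2 * δ ≤ δ₂)
    (hu : ∀ z, |u z| ≤ a * Real.exp (-(δ₁ * ρ p z)))
    (hv' : ∀ z, |v' z| ≤ b * Real.exp (-(δ₂ * min (ρ q₁ z) (ρ q₂ z))))
    (hdu : ∀ z, |u' z - u z| ≤ εA * Real.exp (-(δ₁ * ρ p z)))
    (hdv : ∀ z, |v' z - v z| ≤ εB * Real.exp (-(δ₂ * min (ρ q₁ z) (ρ q₂ z)))) :
    |∑ z, u' z * v' z - ∑ z, u z * v z|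
      ≤ 2 * ((εA * b + a * εB) * K δ) * Real.exp (-(δ * min (ρ p q₁) (ρ p q₂))) := by
  rw [dot2_sub_dot2]
  have b1 := dot2_decay_bound_pair hρ hS p q₁ q₂ (fun z => u' z - u z) v' hεA hb hδ h1 h2 hdu hv'
  have b2 := dot2_decay_bound_pair hρ hS p q₁ q₂ u (fun z => v' z - v z) ha hεB hδ h1 h2 hu hdv
  calc |∑ z, (u' z - u z) * v' z + ∑ z, u z * (v' z - v z)|
      ≤ |∑ z, (u' z - u z) * v' z| + |∑ z, u z * (v' z - v z)| := abs_add_le _ _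
    _ ≤ 2 * (εA * b * K δ) * Real.exp (-(δ * min (ρ p q₁) (ρ p q₂)))
        + 2 * (a * εB * K δ) * Real.exp (-(δ * min (ρ p q₁) (ρ p q₂))) := add_le_add b1 b2
    _ = 2 * ((εA * b + a * εB) * K δ) * Real.exp (-(δ * min (ρ p q₁) (ρ p q₂))) := by ring

end TwoFactor

/-! ## §2 THE KNITS: per-scale two-factor read-outs with one-line rates `∝ θ^{scale X}` ⟹ `NE5` with ONE `θ` -/

section MultiScale

variable {d : ℕ} {C : Carriers} {EA : Functional C C.BgA} {EB : Functional C C.BgB} {W : Set (ℕ → ℝ)}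

/-- **Two-factor knit, one-anchor column.**  Any carriers `C`; a domain `X` of scale `j` reads a row anchor `p X` and a column
anchor `q X` on the scale-`j` unit torus `Π_μ ℤ∕(L·M_j(μ))` with `C.d X ≤ |p X − q X|`; run A's output at `X` is
`Σ_z u_A(X)(z)·v_A(X)(z)`, run B's the primed one; undifferenced sizes `a` (row of run A), `b` (column of run B), one-line
rates `cA·θ^j`, `cB·θ^j`, row decay `δ₁`, column decay `δ₂`, `2δ ≤ δ₁, δ₂` ⟹ `NE5 EA EB W δ θ ((cA·b + a·cB)·K_d(δ))`
(`K_d` = `latticeConst d`, the torus lattice sums `tdistT_sumBound`).  ONE `θ` for ALL scales; `W`, backgrounds, transport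
unread (A = 0 model). [cite: King1986, p.675, Prop. 3.9 (3.73) p.665] -/
theorem ne5_of_twoFactorRates_torus (L : ℕ) [NeZero L] (M : ℕ → Fin d → ℕ) [∀ j μ, NeZero (M j μ)]
    (p q : (X : C.Dom) → Tor (fine L (M (C.scale X))))
    (uA uB vA vB : (X : C.Dom) → Tor (fine L (M (C.scale X))) → ℝ)
    {δ₁ δ₂ δ θ a b cA cB : ℝ} (hδ : 0 < δ) (h1 : 2 * δ ≤ δ₁) (h2 : 2 * δ ≤ δ₂) (hθ : 0 ≤ θ) (ha : 0 ≤ a)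
    (hb : 0 ≤ b) (hcA : 0 ≤ cA) (hcB : 0 ≤ cB)
    (hu : ∀ X z, |uA X z| ≤ a * Real.exp (-(δ₁ * tdistT _ (p X) z)))
    (hv : ∀ X z, |vB X z| ≤ b * Real.exp (-(δ₂ * tdistT _ (q X) z)))
    (hdu : ∀ X z, |uB X z - uA X z| ≤ cA * θ ^ C.scale X * Real.exp (-(δ₁ * tdistT _ (p X) z)))
    (hdv : ∀ X z, |vB X z - vA X z| ≤ cB * θ ^ C.scale X * Real.exp (-(δ₂ * tdistT _ (q X) z)))
    (hd : ∀ X, C.d X ≤ tdistT _ (p X) (q X))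
    (hEA : ∀ g U X, EA g U X = ∑ z, uA X z * vA X z)
    (hEB : ∀ g U X, EB g U X = ∑ z, uB X z * vB X z) :
    NE5 EA EB W δ θ ((cA * b + a * cB) * latticeConst d δ) := by
  intro g _ U X
  rw [hEA, hEB, abs_sub_comm]
  have hθj : 0 ≤ θ ^ C.scale X := pow_nonneg hθ _
  have h := dot2_rate (tdistT_isPseudoDist _) (tdistT_sumBound _) (p X) (q X) (uA X) (uB X) (vA X) (vB X) ha hb
    (mul_nonneg hcA hθj) (mul_nonneg hcB hθj) hδ h1 h2 (hu X) (hv X) (hdu X) (hdv X)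
  refine h.trans ?_
  have hK : 0 ≤ latticeConst d δ := latticeConst_nonneg d hδ.le
  have hexp : Real.exp (-(δ * tdistT _ (p X) (q X))) ≤ Real.exp (-(δ * C.d X)) :=
    Real.exp_le_exp.mpr (neg_le_neg (mul_le_mul_of_nonneg_left (hd X) hδ.le))
  calc (cA * θ ^ C.scale X * b + a * (cB * θ ^ C.scale X)) * latticeConst d δ
          * Real.exp (-(δ * tdistT _ (p X) (q X)))
      = (cA * b + a * cB) * latticeConst d δ * θ ^ C.scale X * Real.exp (-(δ * tdistT _ (p X) (q X))) := by ring
    _ ≤ (cA * b + a * cB) * latticeConst d δ * θ ^ C.scale X * Real.exp (-(δ * C.d X)) :=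
        mul_le_mul_of_nonneg_left hexp (by positivity)

/-- **Two-factor knit, PAIR-anchored column** (the Hölder quotient `∂_α(x, y)` on the minimiser factor): as
`ne5_of_twoFactorRates_torus` with the columns decaying from the nearer of `q₁ X`, `q₂ X` and
`C.d X ≤ min(|p X − q₁ X|, |p X − q₂ X|)` (King's `dist({x, y}, z)`) ⟹ `NE5 EA EB W δ θ (2(cA·b + a·cB)·K_d(δ))`.
[cite: King1986, p.675, Prop. 3.9 (3.75) p.665] -/
theorem ne5_of_twoFactorRates_pair_torus (L : ℕ) [NeZero L] (M : ℕ → Fin d → ℕ) [∀ j μ, NeZero (M j μ)]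
    (p q₁ q₂ : (X : C.Dom) → Tor (fine L (M (C.scale X))))
    (uA uB vA vB : (X : C.Dom) → Tor (fine L (M (C.scale X))) → ℝ)
    {δ₁ δ₂ δ θ a b cA cB : ℝ} (hδ : 0 < δ) (h1 : 2 * δ ≤ δ₁) (h2 : 2 * δ ≤ δ₂) (hθ : 0 ≤ θ) (ha : 0 ≤ a)
    (hb : 0 ≤ b) (hcA : 0 ≤ cA) (hcB : 0 ≤ cB)
    (hu : ∀ X z, |uA X z| ≤ a * Real.exp (-(δ₁ * tdistT _ (p X) z)))
    (hv : ∀ X z, |vB X z| ≤ b * Real.exp (-(δ₂ * min (tdistT _ (q₁ X) z) (tdistT _ (q₂ X) z))))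
    (hdu : ∀ X z, |uB X z - uA X z| ≤ cA * θ ^ C.scale X * Real.exp (-(δ₁ * tdistT _ (p X) z)))
    (hdv : ∀ X z, |vB X z - vA X z|
      ≤ cB * θ ^ C.scale X * Real.exp (-(δ₂ * min (tdistT _ (q₁ X) z) (tdistT _ (q₂ X) z))))
    (hd : ∀ X, C.d X ≤ min (tdistT _ (p X) (q₁ X)) (tdistT _ (p X) (q₂ X)))
    (hEA : ∀ g U X, EA g U X = ∑ z, uA X z * vA X z)
    (hEB : ∀ g U X, EB g U X = ∑ z, uB X z * vB X z) :
    NE5 EA EB W δ θ (2 * ((cA * b + a * cB) * latticeConst d δ)) := by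
  intro g _ U X
  rw [hEA, hEB, abs_sub_comm]
  have hθj : 0 ≤ θ ^ C.scale X := pow_nonneg hθ _
  have h := dot2_rate_pair (tdistT_isPseudoDist _) (tdistT_sumBound _) (p X) (q₁ X) (q₂ X) (uA X) (uB X) (vA X)
    (vB X) ha hb (mul_nonneg hcA hθj) (mul_nonneg hcB hθj) hδ h1 h2 (hu X) (hv X) (hdu X) (hdv X)
  refine h.trans ?_
  have hK : 0 ≤ latticeConst d δ := latticeConst_nonneg d hδ.le
  have hexp : Real.exp (-(δ * min (tdistT _ (p X) (q₁ X)) (tdistT _ (p X) (q₂ X)))) ≤ Real.exp (-(δ * C.d X)) :=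
    Real.exp_le_exp.mpr (neg_le_neg (mul_le_mul_of_nonneg_left (hd X) hδ.le))
  calc 2 * ((cA * θ ^ C.scale X * b + a * (cB * θ ^ C.scale X)) * latticeConst d δ)
          * Real.exp (-(δ * min (tdistT _ (p X) (q₁ X)) (tdistT _ (p X) (q₂ X))))
      = 2 * ((cA * b + a * cB) * latticeConst d δ) * θ ^ C.scale X
          * Real.exp (-(δ * min (tdistT _ (p X) (q₁ X)) (tdistT _ (p X) (q₂ X)))) := by ring
    _ ≤ 2 * ((cA * b + a * cB) * latticeConst d δ) * θ ^ C.scale X * Real.exp (-(δ * C.d X)) :=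
        mul_le_mul_of_nonneg_left hexp (by positivity)

end MultiScale

/-! ## §3 `G^η_{(K)}` is symmetric; the kernel identities for `∂^η_μ`, `∂_α(x, y)`, `∂_α(x, y)∂^η_μ` in the first variable -/

section TopKernel

variable {d : ℕ} (N : ℕ) [NeZero N] (M : Fin d → ℕ) [∀ μ, NeZero (M μ)]

/-- **`G^η_{(K)}` IS SYMMETRIC**: `topPiece N M a c m² x y = topPiece N M a c m² y x` — `N^d(B⁻¹ − A₀⁻¹)` with `B = c(−Δ) + m²`
(`lapF_comm`) and `A₀ = B + aQ*Q` (`fineOp_transpose`) symmetric. [cite: King1986, (2.17) p.653, (4.44) p.675] -/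
theorem topPiece_symm (a c m2 : ℝ) (x y : Tor (fine N M)) : topPiece N M a c m2 x y = topPiece N M a c m2 y x := by
  have hB : (lapF (fine N M) c m2)ᵀ = lapF (fine N M) c m2 := by
    ext z z'
    rw [Matrix.transpose_apply]
    exact lapF_comm (fine N M) c m2 z z'
  have hT : (topPiece N M a c m2)ᵀ = topPiece N M a c m2 := by
    rw [topPiece, Matrix.transpose_smul, Matrix.transpose_sub, Matrix.transpose_nonsing_inv,
      Matrix.transpose_nonsing_inv, hB, fineOp_transpose]
  have h := congrFun (congrFun hT x) y
  rw [Matrix.transpose_apply] at h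
  exact h.symm

/-- **(4.44) READ FROM THE OTHER SIDE**: `G^η_{(K)}(x, y) = Σ_b C^ηQ^*_K(y, b)·ℋ_K(x, b)` (`a, c ≥ 0`, `m² > 0`) — symmetry +
n18-b's `topPiece_kernel_eq_sum`; the operators of Prop. 3.9 act on `x` and therefore on the MINIMISER factor.
[cite: King1986, (4.44) p.675] -/
theorem topPiece_kernel_eq_sum' {a c m2 : ℝ} (ha : 0 ≤ a) (hc : 0 ≤ c) (hm : 0 < m2) (x y : Tor (fine N M)) :
    topPiece N M a c m2 x y
      = ∑ b : Tor M, covQstar N M c m2 (Pi.single b 1) y * minimiser N M a c m2 (Pi.single b 1) x := by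
  rw [topPiece_symm, topPiece_kernel_eq_sum N M ha hc hm y x]

/-- **The lattice derivative of `G^η_{(K)}` in the first variable as a two-factor kernel**:
`r·(G(x + e, y) − G(x, y)) = Σ_b C^ηQ^*_K(y, b)·r(ℋ_K(x + e, b) − ℋ_K(x, b))` (`r = η⁻¹ = L^K`, `e = e_μ` for `∂^η_μ`).
[cite: King1986, Prop. 3.9 (3.73) p.665, (4.44) p.675] -/
theorem dtopPiece_eq_sum {a c m2 : ℝ} (ha : 0 ≤ a) (hc : 0 ≤ c) (hm : 0 < m2) (r : ℝ) (x e y : Tor (fine N M)) :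
    r * (topPiece N M a c m2 (x + e) y - topPiece N M a c m2 x y)
      = ∑ b : Tor M, covQstar N M c m2 (Pi.single b 1) y
          * (r * (minimiser N M a c m2 (Pi.single b 1) (x + e) - minimiser N M a c m2 (Pi.single b 1) x)) := by
  rw [topPiece_kernel_eq_sum' N M ha hc hm (x + e) y, topPiece_kernel_eq_sum' N M ha hc hm x y,
    ← Finset.sum_sub_distrib, Finset.mul_sum]
  exact Finset.sum_congr rfl fun b _ => by ring

/-- **The Hölder quotient of `G^η_{(K)}` as a two-factor kernel**: `r·(G(x, z) − G(y, z)) = Σ_b C^ηQ^*_K(z, b)·r(ℋ_K(x, b) −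
ℋ_K(y, b))` (`r = |x − y|^{−α}` for `(∂_α(x, y)G)(z)`, (3.62)). [cite: King1986, (3.62) p.663, Prop. 3.9 (3.75) p.665, (4.44) p.675] -/
theorem htopPiece_eq_sum {a c m2 : ℝ} (ha : 0 ≤ a) (hc : 0 ≤ c) (hm : 0 < m2) (r : ℝ) (x y z : Tor (fine N M)) :
    r * (topPiece N M a c m2 x z - topPiece N M a c m2 y z)
      = ∑ b : Tor M, covQstar N M c m2 (Pi.single b 1) z
          * (r * (minimiser N M a c m2 (Pi.single b 1) x - minimiser N M a c m2 (Pi.single b 1) y)) := by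
  rw [topPiece_kernel_eq_sum' N M ha hc hm x z, topPiece_kernel_eq_sum' N M ha hc hm y z,
    ← Finset.sum_sub_distrib, Finset.mul_sum]
  exact Finset.sum_congr rfl fun b _ => by ring

/-- **The Hölder quotient of the lattice derivative of `G^η_{(K)}` as a two-factor kernel**:
`r·(s(G(x + e, z) − G(x, z)) − s(G(y + e, z) − G(y, z))) = Σ_b C^ηQ^*_K(z, b)·r(s(ℋ_K(x + e, b) − ℋ_K(x, b)) − s(ℋ_K(y + e, b) −
ℋ_K(y, b)))` (`(∂_α(x, y)∂^η_μG)(z)`). [cite: King1986, (3.62) p.663, Prop. 3.9 (3.75) p.665, (4.44) p.675] -/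
theorem hdtopPiece_eq_sum {a c m2 : ℝ} (ha : 0 ≤ a) (hc : 0 ≤ c) (hm : 0 < m2) (r s : ℝ)
    (x y e z : Tor (fine N M)) :
    r * (s * (topPiece N M a c m2 (x + e) z - topPiece N M a c m2 x z)
        - s * (topPiece N M a c m2 (y + e) z - topPiece N M a c m2 y z))
      = ∑ b : Tor M, covQstar N M c m2 (Pi.single b 1) z
          * (r * (s * (minimiser N M a c m2 (Pi.single b 1) (x + e) - minimiser N M a c m2 (Pi.single b 1) x)
              - s * (minimiser N M a c m2 (Pi.single b 1) (y + e) - minimiser N M a c m2 (Pi.single b 1) y))) := by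
  rw [topPiece_kernel_eq_sum' N M ha hc hm (x + e) z, topPiece_kernel_eq_sum' N M ha hc hm x z,
    topPiece_kernel_eq_sum' N M ha hc hm (y + e) z, topPiece_kernel_eq_sum' N M ha hc hm y z]
  simp only [← Finset.sum_sub_distrib, Finset.mul_sum]
  exact Finset.sum_congr rfl fun b _ => by ring

end TopKernel

end Summit.QuantumFields.YangMills.BalabanUVNodes.N18KingModelTwoFactor

end
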